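import Mathlib
import HarnessLib
import Summits.ResolutionOfSingularities.ResolutionOfSingularities.Theorems.WildQuotientsWildQuotientResolutionS1aChartRingSigma
import Summits.ResolutionOfSingularities.ResolutionOfSingularities.Theorems.WildQuotientsWildQuotientResolutionS1aOneShotKillLocal

/-!
# S1a — THE COBORDANT KILL CERTIFICATE (KC1): one pair of ideal inclusions in `R^w` makes the augmentation ideal of `σʼ` principal on EVERY σ-fixed chart

[OURS · L1 W4.5c · lead-1 g10; plan-1 g13 KILL-CRITERION v1 §2 / SIG KC v1 made theorems] — NOT statements of the manuscript; counted 0;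
AI-level work, weaker than expert review. Crux stmt-ResolutionOfSingularities-17941 `CyclicQuotientFourfolds`, line `s1a-logminvertex` v10, K-side
(`stub_killTouchReachAux`): the kill clause of `RingKillData` / `IsPrincipalChartData` asks, for every σ-fixed cover element `b ∈ K_d`, `d > 0`,
that the augmentation ideal of `σʼ = sigmaChart` on the cobordant chart ring `R^w[(b T^d)⁻¹]` be principal. Route-independent; pure algebra on
Włodarczyk's cobordant algebra `R^w = B[s, fᵢ t^{wᵢ}]` (`cobordantAlgebra f w`).

* `CobordantKillCert f w σ hσJ hp hσp g` — (H1) `augIdeal σ_R ≤ (g)` (every increment `σ_R z − z` is a multiple of ONE `g ∈ R^w`) and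
  (H2) `(g) · vertexIdeal^N ≤ augIdeal σ_R` (`g` generates the augmentation ideal up to the vertex, which every chart of `B₊` inverts);
* `prod_u'_pow_mem_vertexIdeal`, `exists_mem_vertexIdeal_coe_eq`, ★ `coverElement_mem_vertexIdeal` — every element `b T^d` of POSITIVE `t`-degree
  lies in the vertex ideal `(f₁ t^{w₁}, …, f_c t^{w_c})` (a monomial of weight `≥ d ≥ 1` is divisible by some `fᵢ t^{wᵢ}`);
* `augmentationIdeal_sigmaChart_eq_map` — `augIdeal σʼ = (augIdeal σ_R) · R^w[(bT^d)⁻¹]` (augmentation ideals commute with localisation, p590971);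
* ★★ **KC1** `augmentationIdeal_sigmaChart_eq_span_of_cert` — a certificate gives `augIdeal σʼ = (g)` on every σ-fixed chart with `d > 0`, hence
  `isPrincipal_augmentationIdeal_sigmaChart_of_cert`.
-/

set_option linter.dupNamespace false

noncomputable section

open Literature.AlgebraicGeometry.Resolution
open scoped LaurentPolynomial
open LaurentPolynomial
open Summit.ResolutionOfSingularities.ResolutionOfSingularities.Theorems.WildQuotientResolution.S1.CoarseChart

namespace Summit.ResolutionOfSingularities.ResolutionOfSingularities.Theorems.WildQuotientResolution.S1.KillCert

universe u v

section Cert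

variable {B : Type u} [CommRing B] {c : ℕ} (f : Fin c → B) (w : Fin c → ℕ) (σ : B ≃+* B)
  (hσJ : ∀ n : ℕ, ((weightedFiltration f w).ideal n).map (σ : B →+* B) ≤ (weightedFiltration f w).ideal n)
  {p : ℕ} (hp : 0 < p) (hσp : ∀ x : B, (⇑σ)^[p] x = x)

/-- **COBORDANT KILL CERTIFICATE** for `σ` along the weighted centre `(f, w)`: one element `g ∈ R^w = cobordantAlgebra f w` such that
(H1) every increment `σ_R z − z` is a multiple of `g` and (H2) `(g) · vertexIdeal^N ≤ augIdeal σ_R` for some `N`.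
For a genuine kill `g = β · s` (`β` the boundary monomial, `s = t⁻¹`). [OURS · L1 W4.5c · KILL-CRITERION v1 §2; NOT a statement of the manuscript] -/
def CobordantKillCert (g : ↥(cobordantAlgebra f w)) : Prop :=
  augmentationIdeal (sigmaR σ f w hσJ hp hσp) ≤ Ideal.span {g} ∧
    ∃ N : ℕ, Ideal.span {g} * cobordantAlgebra.vertexIdeal f w ^ N ≤ augmentationIdeal (sigmaR σ f w hσJ hp hσp)

/-! ## Positive-degree elements lie in the vertex ideal -/

/-- A non-trivial monomial `∏ (fᵢ t^{wᵢ})^{αᵢ}`, `α ≠ 0`, lies in the vertex ideal `(f₁ t^{w₁}, …, f_c t^{w_c})`. [OURS · L1 W4.5c] -/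
theorem prod_u'_pow_mem_vertexIdeal {α : Fin c →₀ ℕ} (hα : α ≠ 0) :
    (α.prod fun i e => cobordantAlgebra.u' f w i ^ e) ∈ cobordantAlgebra.vertexIdeal f w := by
  obtain ⟨i, hi⟩ := Finsupp.ne_iff.mp hα
  rw [Finsupp.coe_zero, Pi.zero_apply] at hi
  have hi' : i ∈ α.support := Finsupp.mem_support_iff.mpr hi
  have hdvd : cobordantAlgebra.u' f w i ∣ α.prod fun i e => cobordantAlgebra.u' f w i ^ e :=
    (dvd_pow_self _ hi).trans (Finset.dvd_prod_of_mem (fun j => cobordantAlgebra.u' f w j ^ α j) hi')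
  obtain ⟨q, hq⟩ := hdvd
  rw [hq]
  exact Ideal.mul_mem_right _ _ (cobordantAlgebra.u'_mem_vertexIdeal f w i)

/-- For `b ∈ 𝒥_d` with `d > 0`, the element `b T^d ∈ R^w` lies in the vertex ideal: a monomial `f^α` of weight `W ≥ d ≥ 1` gives
`f^α T^d = (∏ (fᵢt^{wᵢ})^{αᵢ}) · s^{W − d}` with `α ≠ 0`. [OURS · L1 W4.5c] -/
theorem exists_mem_vertexIdeal_coe_eq {d : ℕ} (hd : 0 < d) {b : B} (hb : b ∈ (weightedFiltration f w).ideal d) :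
    ∃ z ∈ cobordantAlgebra.vertexIdeal f w, (z : B[T;T⁻¹]) = C b * T (d : ℤ) := by
  rw [weightedFiltration_ideal] at hb
  induction hb using Submodule.span_induction with
  | mem m hm =>
    obtain ⟨α, hα, rfl⟩ := hm
    have hα0 : α ≠ 0 := by
      rintro rfl
      rw [map_zero] at hα
      omega
    refine ⟨(α.prod fun i e => cobordantAlgebra.u' f w i ^ e) * cobordantAlgebra.s f w ^ (Finsupp.weight w α - d),
      Ideal.mul_mem_right _ _ (prod_u'_pow_mem_vertexIdeal f w hα0), ?_⟩
    rw [MulMemClass.coe_mul, coe_prod_u'_pow, cobordantAlgebra.coe_s_pow, mul_assoc, ← T_add]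
    congr 2
    rw [Nat.cast_sub hα]
    ring
  | zero => exact ⟨0, Ideal.zero_mem _, by rw [ZeroMemClass.coe_zero, map_zero, zero_mul]⟩
  | add a b _ _ ha hb =>
    obtain ⟨z₁, hz₁, e₁⟩ := ha
    obtain ⟨z₂, hz₂, e₂⟩ := hb
    exact ⟨z₁ + z₂, Ideal.add_mem _ hz₁ hz₂, by rw [AddMemClass.coe_add, e₁, e₂, map_add, add_mul]⟩
  | smul r a _ ha =>
    obtain ⟨z, hz, e⟩ := ha
    refine ⟨algebraMap B _ r * z, Ideal.mul_mem_left _ _ hz, ?_⟩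
    rw [MulMemClass.coe_mul, cobordantAlgebra.coe_algebraMap, e, smul_eq_mul, map_mul, mul_assoc]

/-- ★ **The cover element `b T^d`, `b ∈ K_d`, `d > 0`, lies in the vertex ideal** — so it is inverted on no chart meeting the vertex, and (H2) of a
certificate becomes `g ∈ augIdeal σʼ` on the chart `R^w[(bT^d)⁻¹]`. [OURS · L1 W4.5c · SIG KC v1 `coverElement_mem_vertexIdeal`] -/
theorem coverElement_mem_vertexIdeal {ι : Type v} [AddCommGroup ι] [DecidableEq ι] (𝒜 : ι → AddSubgroup B)
    [GradedRing 𝒜] {d : ℕ} (hd : 0 < d) (b : ↥(𝒜 0)) (hb : b ∈ (traceFiltration 𝒜 f w).ideal d) :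
    coverElement 𝒜 f w d b hb ∈ cobordantAlgebra.vertexIdeal f w := by
  obtain ⟨z, hz, e⟩ := exists_mem_vertexIdeal_coe_eq f w hd ((mem_traceFiltration_iff 𝒜 f w).mp hb)
  have hzb : z = coverElement 𝒜 f w d b hb := Subtype.ext (by rw [e, coe_coverElement])
  rwa [hzb] at hz

/-! ## KC1: a certificate kills every σ-fixed chart -/

/-- **`augIdeal σʼ = (augIdeal σ_R) · R^w[(b T^d)⁻¹]`**: the augmentation ideal of the chart automorphism `σʼ = sigmaChart` is the extension of the
augmentation ideal of `σ_R` (augmentation ideals commute with localisation, `OneShotKill.augmentationIdeal_ringEquivOfRingEquiv`). [OURS · L1 W4.5c] -/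
theorem augmentationIdeal_sigmaChart_eq_map {ι : Type v} [AddCommGroup ι] [DecidableEq ι] (𝒜 : ι → AddSubgroup B)
    [GradedRing 𝒜] {d : ℕ} (b : ↥(𝒜 0)) (hb : b ∈ (traceFiltration 𝒜 f w).ideal d) (hσb : σ (b : B) = b) :
    augmentationIdeal (sigmaChart 𝒜 f w d b hb σ hσJ hp hσp hσb) =
      (augmentationIdeal (sigmaR σ f w hσJ hp hσp)).map (algebraMap _ (ChartRing 𝒜 f w d b hb)) :=
  OneShotKill.augmentationIdeal_ringEquivOfRingEquiv (S := ChartRing 𝒜 f w d b hb) (sigmaR σ f w hσJ hp hσp)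
    (map_powers_coverElement 𝒜 f w d b hb σ hσJ hp hσp hσb)

/-- ★★ **KC1.** A cobordant kill certificate `g` makes the augmentation ideal of `σʼ = sigmaChart` on EVERY σ-fixed chart `R^w[(b T^d)⁻¹]`,
`d > 0`, equal to `(g)`: `≤` from (H1) (`augIdeal σʼ = (augIdeal σ_R)·R_b ≤ (g)·R_b`); `≥` from (H2) with `h = bT^d ∈ vertexIdeal`
(`coverElement_mem_vertexIdeal`): `g·h^N ∈ augIdeal σ_R` and `h` is a unit of `R_b`.
[OURS · L1 W4.5c · KILL-CRITERION v1 KC1; NOT a statement of the manuscript] -/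
theorem augmentationIdeal_sigmaChart_eq_span_of_cert {ι : Type v} [AddCommGroup ι] [DecidableEq ι]
    (𝒜 : ι → AddSubgroup B) [GradedRing 𝒜] {d : ℕ} (hd : 0 < d) (b : ↥(𝒜 0))
    (hb : b ∈ (traceFiltration 𝒜 f w).ideal d) (hσb : σ (b : B) = b)
    {g : ↥(cobordantAlgebra f w)} (hcert : CobordantKillCert f w σ hσJ hp hσp g) :
    augmentationIdeal (sigmaChart 𝒜 f w d b hb σ hσJ hp hσp hσb) =
      Ideal.span {algebraMap (↥(cobordantAlgebra f w)) (ChartRing 𝒜 f w d b hb) g} := by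
  obtain ⟨h1, N, h2⟩ := hcert
  rw [augmentationIdeal_sigmaChart_eq_map]
  apply le_antisymm
  · refine (Ideal.map_mono h1).trans ?_
    rw [Ideal.map_span, Set.image_singleton]
  · rw [Ideal.span_singleton_le_iff_mem]
    have hmem : g * coverElement 𝒜 f w d b hb ^ N ∈ augmentationIdeal (sigmaR σ f w hσJ hp hσp) :=
      h2 (Ideal.mul_mem_mul (Ideal.mem_span_singleton_self g)
        (Ideal.pow_mem_pow (coverElement_mem_vertexIdeal f w 𝒜 hd b hb) N))
    have hmap := Ideal.mem_map_of_mem (algebraMap (↥(cobordantAlgebra f w)) (ChartRing 𝒜 f w d b hb)) hmem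
    rw [map_mul, map_pow] at hmap
    have hU : IsUnit (algebraMap (↥(cobordantAlgebra f w)) (ChartRing 𝒜 f w d b hb) (coverElement 𝒜 f w d b hb) ^ N) :=
      (IsLocalization.Away.algebraMap_isUnit (coverElement 𝒜 f w d b hb)).pow N
    exact (Ideal.mul_unit_mem_iff_mem _ hU).mp hmap

/-- **KC1ʼ.** … hence the augmentation ideal of `σʼ` is principal on every σ-fixed chart with `d > 0` — the kill clause of `RingKillData`.
[OURS · L1 W4.5c · KILL-CRITERION v1 KC1ʼ; NOT a statement of the manuscript] -/
theorem isPrincipal_augmentationIdeal_sigmaChart_of_cert {ι : Type v} [AddCommGroup ι] [DecidableEq ι]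
    (𝒜 : ι → AddSubgroup B) [GradedRing 𝒜] {d : ℕ} (hd : 0 < d) (b : ↥(𝒜 0))
    (hb : b ∈ (traceFiltration 𝒜 f w).ideal d) (hσb : σ (b : B) = b)
    {g : ↥(cobordantAlgebra f w)} (hcert : CobordantKillCert f w σ hσJ hp hσp g) :
    (augmentationIdeal (sigmaChart 𝒜 f w d b hb σ hσJ hp hσp hσb)).IsPrincipal :=
  ⟨⟨_, by rw [augmentationIdeal_sigmaChart_eq_span_of_cert f w σ hσJ hp hσp 𝒜 hd b hb hσb hcert,
    Ideal.submodule_span_eq]⟩⟩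

end Cert

end Summit.ResolutionOfSingularities.ResolutionOfSingularities.Theorems.WildQuotientResolution.S1.KillCert

end
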